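import Summits.BirchSwinnertonDyer.BirchSwinnertonDyer.Theorems.EisensteinDepletionAtTwoStarPrimeLevelModels
import HarnessLib

/-!
# Route `EisensteinDepletionAtTwo`, crux E1M `DepletedLambdaLawAtTwoMod` (item stmt-BirchSwinnertonDyer-20341),
# line `star` — EXACTLY WHEN an admissible stabilisation datum exists (the hidden level-content of (★-SymbC))

Cell `bsd-rank2`, seat `bsd-rank2-eng-2` GEN 9. THEOREMS ONLY; no `sorry`. HONEST FRAMING: finite bookkeeping on `Nat.factorization`;
nothing reads an analytic rank; (★-SymbC)/(★)/E1M are NOT proved; BSD is not proved by any of this (PARTITION D-0054: none).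

The research stub `stub_starSymbC` (skeleton v3.3/v3.4 of `Cruxes/DepletedLambdaLawAtTwoMod/Lines/star.lean`) concludes
`∃ β, IsAdmissibleStabData N_W β ∧ …` under the level hypothesis `¬ N_W.Prime` («admissible data then exist», skeleton docstring).
This file pins down the EXACT level condition:

  `(∃ β, IsAdmissibleStabData N β) ↔ N ≠ 0 ∧ N ≠ 1 ∧ ¬ N.Prime ∧ ∀ ℓ ∈ N.primeFactors, N.factorization ℓ ≤ 2`
  (`exists_isAdmissibleStabData_iff`),

so besides «not prime» the stub silently asserts of every habitat curve that `N_W ∉ {0, 1}` (`N_W ≠ 0`: the conductor is a nonzero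
ideal; `N_W ≠ 1`: no elliptic curve over `ℚ` has everywhere good reduction — Tate/Ogg, print) and that `N_W` is CUBE-FREE
(`ord_ℓ N_W ≤ 2`: automatic for `ℓ ≥ 5`, `ℓ = 2` by good reduction, and at `ℓ = 3` it is Ogg–Saito: the wild exponent at `3` is the
Swan conductor of `W[2]`, trivial when `W[2]` has a rational line — print, the route's `hOgg`-type input; census p2 GEN 20/21: 0 of
2232 classes of odd conductor `N < 10⁴` with a rational `2`-torsion point have a prime exponent `≥ 3`). Nothing here is deep; it
makes the displayed hypotheses of the line honest (lead: add «`N_W ≠ 1` ∧ cube-free», or their print sources, next to `¬ N_W.Prime`).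

References: G. Stevens, *Arithmetic on Modular Curves* (1982) §2.4–2.5 (admissible stabilisations) [Stevens1982];
A. Ogg, *Elliptic curves and wild ramification*, Amer. J. Math. 89 (1967) [folklore citation; not used in proofs].
-/

set_option linter.dupNamespace false
set_option autoImplicit false

namespace Summit.BirchSwinnertonDyer.BirchSwinnertonDyer.Theorems.DepletionAtTwo

/-- An admissible stabilisation datum forces `N ≠ 0`, `N ≠ 1` (there must be a prime factor), `N` not prime
(`not_isAdmissibleStabData_of_prime`) and `N` cube-free (all exponents `≤ 2`).
[cite: Stevens1982, §2.4–2.5 (PDF pp. 35–38) (the admissibility conditions)] -/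
theorem IsAdmissibleStabData.level_conditions {N : ℕ} {β : ℕ → ℕ} (h : IsAdmissibleStabData N β) :
    N ≠ 0 ∧ N ≠ 1 ∧ ¬ N.Prime ∧ ∀ ℓ ∈ N.primeFactors, N.factorization ℓ ≤ 2 := by
  have hne : N.primeFactors.Nonempty := by
    rcases h.2.2 with ⟨ℓ, hℓ, -⟩ | ⟨⟨ℓ, hℓ, -⟩, -⟩ <;> exact ⟨ℓ, hℓ⟩
  refine ⟨?_, ?_, fun hp ↦ not_isAdmissibleStabData_of_prime hp β h, h.1⟩
  · rintro rfl; simp at hne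
  · rintro rfl; simp at hne

/-- Conversely, at a cube-free level `N ∉ {0, 1}` that is not prime an admissible datum EXISTS: if some `ℓ² ∥ N` take `β ≡ 1`
(full depletion at `ℓ` makes the product non-critical); otherwise `N` is squarefree with at least two prime factors `ℓ₁ ≠ ℓ₂`,
and `β ℓ₁ = ℓ₁`, `β = 1` elsewhere is admissible. [cite: Stevens1982, §2.4–2.5 (PDF pp. 35–38) (the admissibility conditions)] -/
theorem exists_isAdmissibleStabData {N : ℕ} (h0 : N ≠ 0) (h1 : N ≠ 1) (hp : ¬ N.Prime)
    (hcf : ∀ ℓ ∈ N.primeFactors, N.factorization ℓ ≤ 2) : ∃ β : ℕ → ℕ, IsAdmissibleStabData N β := by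
  by_cases hsq : ∃ ℓ ∈ N.primeFactors, N.factorization ℓ = 2
  · exact ⟨fun _ ↦ 1, hcf, fun ℓ _ _ ↦ Or.inl rfl, Or.inl hsq⟩
  · -- squarefree case: every exponent is `1`; pick two distinct prime factors
    push Not at hsq
    have hone : ∀ ℓ ∈ N.primeFactors, N.factorization ℓ = 1 := by
      intro ℓ hℓ
      have hle := hcf ℓ hℓ
      have hpos : 0 < N.factorization ℓ := Nat.Prime.factorization_pos_of_dvd (Nat.prime_of_mem_primeFactors hℓ) h0
        (Nat.dvd_of_mem_primeFactors hℓ)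
      have hne2 := hsq ℓ hℓ
      omega
    set ℓ₁ := N.minFac with hℓ₁
    have hℓ₁p : ℓ₁.Prime := Nat.minFac_prime h1
    have hℓ₁N : ℓ₁ ∣ N := Nat.minFac_dvd N
    have hℓ₁mem : ℓ₁ ∈ N.primeFactors := Nat.mem_primeFactors.mpr ⟨hℓ₁p, hℓ₁N, h0⟩
    -- a second prime factor `ℓ₂ ≠ ℓ₁` of `N`: a prime factor of `N / ℓ₁ > 1`
    have hM1 : N / ℓ₁ ≠ 1 := by
      intro hM
      have : N = ℓ₁ := by
        have := Nat.div_mul_cancel hℓ₁N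
        rw [hM, one_mul] at this
        exact this.symm
      exact hp (this ▸ hℓ₁p)
    have hM0 : N / ℓ₁ ≠ 0 := by
      intro hM
      have := Nat.div_mul_cancel hℓ₁N
      rw [hM, zero_mul] at this
      exact h0 this.symm
    set ℓ₂ := (N / ℓ₁).minFac with hℓ₂
    have hℓ₂p : ℓ₂.Prime := Nat.minFac_prime hM1
    have hℓ₂M : ℓ₂ ∣ N / ℓ₁ := Nat.minFac_dvd _
    have hℓ₂N : ℓ₂ ∣ N := dvd_trans hℓ₂M (Nat.div_dvd_of_dvd hℓ₁N)
    have hℓ₂mem : ℓ₂ ∈ N.primeFactors := Nat.mem_primeFactors.mpr ⟨hℓ₂p, hℓ₂N, h0⟩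
    have hne : ℓ₁ ≠ ℓ₂ := by
      intro heq
      -- then `ℓ₁² ∣ N`, contradicting exponent `1`
      have hsqd : ℓ₁ * ℓ₁ ∣ N := by
        have := Nat.mul_dvd_mul_left ℓ₁ (heq ▸ hℓ₂M : ℓ₁ ∣ N / ℓ₁)
        rwa [Nat.mul_div_cancel' hℓ₁N] at this
      have h2 : 2 ≤ N.factorization ℓ₁ := by
        rw [← sq] at hsqd
        exact (Nat.Prime.pow_dvd_iff_le_factorization hℓ₁p h0).mp hsqd
      have := hone ℓ₁ hℓ₁mem
      omega
    refine ⟨fun ℓ ↦ if ℓ = ℓ₁ then ℓ₁ else 1, hcf, ?_, Or.inr ⟨⟨ℓ₁, hℓ₁mem, by simp⟩, ⟨ℓ₂, hℓ₂mem, by simp [Ne.symm hne]⟩⟩⟩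
    intro ℓ _ _
    by_cases hℓ : ℓ = ℓ₁
    · right; simp [hℓ]
    · left; simp [hℓ]

/-- **Exactly when an admissible stabilisation datum exists**: `N ∉ {0, 1}`, `N` not prime, `N` cube-free. Hence the `∃ β`-conclusion
of the research stub (★-SymbC) carries, besides `¬ N_W.Prime`, the hidden level content «`N_W ≠ 1` (Tate: no curve of conductor `1`)
and `N_W` cube-free (Ogg–Saito at `3` for curves with a rational `2`-torsion point)» — both print, to be displayed by the line.
[cite: Stevens1982, §2.4–2.5 (PDF pp. 35–38) (the admissibility conditions)] -/
theorem exists_isAdmissibleStabData_iff (N : ℕ) :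
    (∃ β : ℕ → ℕ, IsAdmissibleStabData N β) ↔
      N ≠ 0 ∧ N ≠ 1 ∧ ¬ N.Prime ∧ ∀ ℓ ∈ N.primeFactors, N.factorization ℓ ≤ 2 :=
  ⟨fun ⟨_, h⟩ ↦ h.level_conditions, fun ⟨h0, h1, hp, hcf⟩ ↦ exists_isAdmissibleStabData h0 h1 hp hcf⟩

end Summit.BirchSwinnertonDyer.BirchSwinnertonDyer.Theorems.DepletionAtTwo
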